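import Summits.HodgeConjecture.HodgeConjecture.Theorems.MarkmanPartnerTransportRMTypeOrbitDensity
import Summits.HodgeConjecture.HodgeConjecture.Theorems.MarkmanPartnerTransportRMTypeOpenDefs
import HarnessLib

/-!
# Route MarkmanPartnerTransport · crux `PicardThreeK3Squares` (stmt-HodgeConjecture-19652) —
# (T′) RM-TYPE DESCENT FROM AN OPEN SET: HC⁴(S × S) for EVERY K3 surface of a rational real-multiplication
# type that is cycle-induced on a non-empty open subset of its Hodge locus

Cell hodge-nonav, crux #4 (HC⁴(S ⊗ S), ρ(S) ≥ 3; open core: real multiplication), programme «RATIONAL ORBIT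
DENSITY» (prover seat hodge-nonav-19652-p1 gen 10; `--supports stmt-HodgeConjecture-19652`, helper).
CONDITIONAL on the named facts `Buskin2019_hodgeIsometry_algebraic`, `Huybrechts_K3_periodSurjective_projective`
and on the DISPLAYED input `RMTypeOpen θ` (`…RMTypeOpenDefs`); credits nothing; nothing here says HC is proved.

THE POINT. The cell's RM-type descent (`RMTypeDescent.hodgeConjectureFor_square_of_rmTypeDominated`,
p620943) needs the cycle for `θ` at EVERY `θ`-eigen period (`RMTypeDominated θ`), i.e. a spread of the
cycle over the whole real-multiplication component (universal family + Deligne's invariant cycles — moduli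
carriers the tree does not have). By RATIONAL ORBIT DENSITY
(`RMTypeOrbit.exists_ratIsometry_commute_smul_mem_of_isOpen`, files `…RMTypeOrbit{Symmetries,ModelVectors,
Transitivity,Density}`, fact-free: the centraliser `G_θ(ℚ) ⊂ O(Λ_ℚ)` of `θ` has DENSE orbits on the Hodge
locus `D_{θ,e}`) the period of ANY surface of type `θ` can be moved, inside its isogeny class and without
changing `θ`, into any given open subset of `D_{θ,e}`; so a cycle for `θ` on an OPEN SET of periods suffices:

* `markedK3_smul` — the crux's marking clause is invariant under rescaling the period (`y ↦ c·y`, `c ≠ 0`);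
* `hodgeConjectureFor_square_of_open` — **(T′)**: marked RM K3 surface `(S, η, p, x)`, admissible generator
  `t` (rational, kills `N¹`, generates `End_Hdg T(S)`, `t(η⁻¹x) = e·η⁻¹x` with `e ≠ 0` real), rational
  isometry `σ` with `σηt = θ_ℂση`, `θ` self-adjoint with an eigenprojector certificate `π ∈ ℂ[X]`
  (`π(e) = 1`, `(θ_ℂ − e)·π(θ_ℂ)·θ_ℂ = 0`), and the `e`-component of `RMTypeOpen θ` ⟹ `HodgeConjectureFor 4
  (S ⊗ S)`. Proof: `σx ∈ D_{θ,e}` is `θ`-generic (Lefschetz `(1,1)` on `S`) and `θ` kills the positive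
  rational vector `σ(u)`, `u` the marking's ample witness; orbit density gives `g ∈ G_θ(ℚ)`, `c ≠ 0` with
  `c·gσx ∈ U`; `σ₁ = gσ` still conjugates `t` to `θ`; a marked K3 surface at `c·σ₁x` exists (period
  surjectivity, `exists_markedK3_ratIsometry` + `markedK3_smul`) and carries the cycle by the input
  (`θ`-genericity transported along `g`); steps (e)–(g) VERBATIM as in p620943: Buskin for `η'⁻¹σ₁η` and
  `η⁻¹σ₁⁻¹η'`, composition of the three correspondences (`corrComp_K3_of_cup`), Varesco's bookkeeping
  (`SquareOfGenerator.squareOfGenerator`);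
* `rmTypeOpen_of_rmTypeDominated` — the new input is WEAKER: `RMTypeDominated θ → RMTypeOpen θ` (`θ`
  self-adjoint; `U = Λ_ℂ`, cycle from `RMSpreadFamily.exists_algebraicClass'`, unconditional);
* `hodgeConjectureFor_square_of_rmTypeOpen` — (T′) consuming `RMTypeOpen θ` BY NAME, with the binders of
  p620943 (`IsRealMultiplicationK3 S ρ P`, …) plus `e`, `he`, `hte`, `π`, `hπe`, `hπW`.

Companion `…PicardThreeK3SquaresRMTypeOpenness`: the θ-free OPENNESS PRINCIPLE (HC⁴ on an open set of
`D_{θ,e}` ⇒ HC⁴ at every `θ`-generic point of `D_{θ,e}`, by orbit density + Buskin's isogeny invariance).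
Intended discharge of `RMTypeOpen θ` for a maximal van Geemen–Schütt type (ζ₉⁺ ρ = 10, √2 ρ = 10, ζ₁₁⁺
ρ = 2): «period image of the family has non-empty interior (maximality + local Torelli) + §4.8 cycle on every
member» — no universal family, no flat section, no monodromy. No definition, no sorry.

References: van Geemen–Schütt, Forum Math. Sigma 13 (2025) e2, §3.4, §4.8; Buskin, J. reine angew. Math.
755 (2019), Thm. 1.1, §6.2 Lemma 6.3; Huybrechts, *Lectures on K3 Surfaces*, Ch. 6 Prop. 1.2, Prop. 1.5,
Rem. 3.3, Ch. 7 Thm. 4.1; Varesco, Math. Z. 305 (2023) art. 69, §2; O'Meara, *Introduction to Quadratic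
Forms*, §42–§43B; Iversen, *Hyperbolic Geometry*, Ch. I §2 Prop. 2.3.
-/

set_option linter.dupNamespace false

noncomputable section

namespace Summit.HodgeConjecture.HodgeConjecture.Theorems.MarkmanPartnerTransport.RMTypeOrbit

open CategoryTheory MonoidalCategory Polynomial
open Literature.AlgebraicGeometry Literature.AlgebraicGeometry.Motives Literature.AlgebraicGeometry.HodgeTheory
open Literature.AlgebraicGeometry.Surfaces Literature.LinearAlgebra.QuadraticForm
open Literature.AlgebraicTopology.SingularHomology
open Summit.HodgeConjecture.HodgeConjecture.Theorems.NikulinTwinTransport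
open Summit.HodgeConjecture.HodgeConjecture.Theorems.MarkmanPartnerTransport.IsogenyInvariance
open Summit.HodgeConjecture.HodgeConjecture.Theorems.MarkmanPartnerTransport.RMTypeDescent

/-- `MarkedK3[S, η, p, x]`: VERBATIM the `let MarkedK3 := …` binder of the route declaration
`PicardThreeK3Squares` (as in `…RMTypeDescent`). Local notation only. -/
local notation3 (prettyPrint := false) "MarkedK3[" S ", " η ", " p ", " x "]" =>
  (p ≠ 0 ∧ (IsIntegralClass p ∧
    (∀ q : complexBetti S (2 * 2), IsIntegralClass q → ∃ n : ℤ, q = n • p) ∧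
    (∀ c : complexBetti S (2 * 1), IsIntegralClass c ↔ ∃ v : K3Index → ℤ, η c = fun i => (v i : ℂ)) ∧
    (∀ a b : complexBetti S (2 * 1),
      cupProduct (rfl : 2 * 1 + 2 * 1 = 2 * 2) a b = k3Form (η a) (η b) • p) ∧
    IsOfHodgeType 2 S (2 * 1) 2 0 (LinearEquiv.symm η x) ∧
    (∀ τ : complexBetti S (2 * 1), IsOfHodgeType 2 S (2 * 1) 2 0 τ →
      ∃ t : ℂ, τ = t • LinearEquiv.symm η x)) ∧
    (k3Form x x = 0 ∧ 0 < (k3Form (star x) x).re ∧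
      ∃ u : K3Index → ℤ, k3Form (fun i => (u i : ℂ)) x = 0 ∧ 0 < ∑ i, ∑ j, u i * k3Gram i j * u j))

/-- `Cycle[θ, e, U]`: **`θ` is cycle-induced on the open set `U` of the Hodge locus `D_{θ,e}`** — every
marked projective K3 surface `(S', η', p', y)` whose period `y ∈ U` is a `θ`-generic `e`-eigenvector of
`θ_ℂ` carries an algebraic class on `S' × S'` inducing `η'⁻¹ θ_ℂ η'`. Local notation only. -/
local notation3 (prettyPrint := false) "Cycle[" θ ", " e ", " U "]" =>
  (∀ (S' : SchemeOver ℂ) (hS' : IsK3Surface S') (η' : complexBetti S' (2 * 1) ≃ₗ[ℂ] (K3Index → ℂ))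
    (p' : complexBetti S' (2 * 2)) (y : K3Index → ℂ), y ∈ U → MarkedK3[S', η', p', y] →
    thetaC θ y = (e : ℂ) • y →
    (∀ v : K3Index → ℚ, k3Form (fun i => (v i : ℂ)) y = 0 → Matrix.mulVec θ v = 0) →
    ∃ γ' ∈ algebraicClasses (S' ⊗ S') 2, ∀ z : complexBetti S' (2 * 1),
      (η'.symm.toLinearMap ∘ₗ (thetaC θ ∘ₗ η'.toLinearMap)) z =
        complexGysin complexOrientationFamily
          (IsSmoothProjective.tensor_holds hS'.isSmoothProjective hS'.isSmoothProjective)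
          hS'.isSmoothProjective (SemiCartesianMonoidalCategory.fst S' S')
          (rfl : 2 * 1 + 2 * 2 + 2 * 2 = 2 * 1 + 2 * (2 + 2))
          (cupProduct (rfl : 2 * 1 + 2 * 2 = 2 * 1 + 2 * 2)
            (complexBetti.map (SemiCartesianMonoidalCategory.snd S' S') (2 * 1) z) γ'))

/-- `Open[θ, e]`: **the RM type `θ` is cycle-induced on an open set of its Hodge locus at the
eigenvalue `e`** — as soon as `D_{θ,e}` contains a `θ`-generic period point, some OPEN `U ⊂ Λ_ℂ` meets
`D_{θ,e}` and `θ` is cycle-induced on `U` (`Cycle[θ, e, U]`). This is the `e`-component of the displayed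
input `RMTypeOpen θ` (`…RMTypeOpenDefs`). Local notation only. -/
local notation3 (prettyPrint := false) "Open[" θ ", " e "]" =>
  (∀ y₀ : K3Index → ℂ, thetaC θ y₀ = (e : ℂ) • y₀ → k3Form y₀ y₀ = 0 → 0 < (k3Form (star y₀) y₀).re →
    (∀ v : K3Index → ℚ, k3Form (fun i => (v i : ℂ)) y₀ = 0 → Matrix.mulVec θ v = 0) →
    ∃ U : Set (K3Index → ℂ), IsOpen U ∧
      (∃ y₁ ∈ U, thetaC θ y₁ = (e : ℂ) • y₁ ∧ k3Form y₁ y₁ = 0 ∧ 0 < (k3Form (star y₁) y₁).re) ∧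
      Cycle[θ, e, U])

variable {S : SchemeOver ℂ}

/-- **Re-marking by a scalar**: the marking clause of the crux is invariant under `y ↦ c·y`, `c ≠ 0`.
[cite: Huybrechts2016K3, Ch. 6 §1.1 (periods are lines)] -/
theorem markedK3_smul {S' : SchemeOver ℂ} {η' : complexBetti S' (2 * 1) ≃ₗ[ℂ] (K3Index → ℂ)}
    {p' : complexBetti S' (2 * 2)} {y : K3Index → ℂ} (hM : MarkedK3[S', η', p', y]) {c : ℂ} (hc : c ≠ 0) :
    MarkedK3[S', η', p', c • y] := by
  obtain ⟨hp0, ⟨hpint, hpgen, hηint, hηcup, h20, hline⟩, hyy, hypos, u, huy, hupos⟩ := hM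
  refine ⟨hp0, ⟨hpint, hpgen, hηint, hηcup, ?_, ?_⟩, ?_, ?_, u, ?_, hupos⟩
  · rw [map_smul]; exact IsOfHodgeType.smul h20 c
  · intro τ hτ
    obtain ⟨t, rfl⟩ := hline τ hτ
    exact ⟨t * c⁻¹, by rw [map_smul, smul_smul, inv_mul_cancel_right₀ hc]⟩
  · rw [k3Form_smul_left, k3Form_smul_right, hyy, mul_zero, mul_zero]
  · have hcc : star c * c = ((‖c‖ ^ 2 : ℝ) : ℂ) := by
      rw [Complex.star_def, Complex.conj_mul', Complex.ofReal_pow]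
    rw [star_smul, k3Form_smul_left, k3Form_smul_right, ← mul_assoc, hcc, Complex.re_ofReal_mul]
    exact mul_pos (pow_pos (norm_pos_iff.2 hc) 2) hypos
  · rw [k3Form_smul_right, huy, mul_zero]


/-- **(T′) RM-TYPE DESCENT FROM AN OPEN SET** — the displayed moduli input of the RM-type descent
(`RMTypeDominated θ`: a cycle for `θ` at EVERY `θ`-eigen period; p620943) WEAKENED to a cycle for `θ`
at the marked K3 surfaces whose periods lie in some non-empty OPEN subset `U` of the Hodge locus
`D_{θ,e}`. For an RM K3 surface `S` marked by `(η, p, x)` with admissible generator `t` of `End_Hdg T(S)`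
(rational, type-preserving, killing `N¹(S)`, generating; `(2,0)`-eigenvalue `e ≠ 0`, real), a rational
isometry `σ ∈ O(Λ_ℚ)` conjugating `t` in the marking to the self-adjoint model endomorphism `θ`
(`σ η t = θ_ℂ σ η`) and an eigenprojector certificate `π` for `(θ, e)`: if `θ` is cycle-induced on an open
`U ⊂ Λ_ℂ` meeting `D_{θ,e}` (`Cycle[θ, e, U]`), then `HodgeConjectureFor 4 (S ⊗ S)`.
PROOF: by RATIONAL ORBIT DENSITY (`exists_ratIsometry_commute_smul_mem_of_isOpen`, fact-free) some
`g ∈ G_θ(ℚ)` moves the period `σ x` into `U` (up to a scalar); `σ₁ = g σ` again conjugates `t` to `θ`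
(`g` commutes with `θ_ℂ`); a marked K3 surface at the period `c·σ₁ x ∈ U` exists (period surjectivity)
and carries the cycle (the displayed input; `θ`-genericity is transported from `S` by Lefschetz `(1,1)`);
the cycle is transported back to `S` along Buskin's algebraic isometries `η'⁻¹σ₁η`, `η⁻¹σ₁⁻¹η'` and
composed (Fulton 16.1.1), and Varesco's bookkeeping over `ℚ[t]` (`SquareOfGenerator.squareOfGenerator`)
concludes — steps (e)–(g) VERBATIM as in `hodgeConjectureFor_square_of_rmTypeDominated`.
CONDITIONAL on {`Buskin2019_hodgeIsometry_algebraic`, `Huybrechts_K3_periodSurjective_projective`} and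
the displayed open-set input; credits nothing; HC is NOT proved here.
[cite: GeemenSchutt2023, §3.4 and §4.8] [cite: Buskin2019, Thm. 1.1 and §6.2 Lemma 6.3]
[cite: Huybrechts2016K3, Ch. 6 Prop. 1.2, Rem. 3.3 and Ch. 7 Thm. 4.1] [cite: Varesco2023, §2 (p. 8)]
[cite: Omeara1963, §42–§43B] [cite: Iversen1992, Ch. I §2 Prop. 2.3] -/
theorem hodgeConjectureFor_square_of_open
    (hB : Buskin2019_hodgeIsometry_algebraic) (hPS : Huybrechts_K3_periodSurjective_projective)
    {θ : Matrix K3Index K3Index ℚ}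
    (hθsa : ∀ a b : K3Index → ℂ, k3Form (thetaC θ a) b = k3Form a (thetaC θ b))
    {e : ℝ} (he : e ≠ 0) {π : ℂ[X]} (hπe : π.eval (e : ℂ) = 1)
    (hπW : ∀ y : K3Index → ℂ,
      thetaC θ (aeval (thetaC θ) π (thetaC θ y)) = (e : ℂ) • aeval (thetaC θ) π (thetaC θ y))
    (hOpen : Open[θ, e])
    (hS : IsK3Surface S)
    (η : complexBetti S (2 * 1) ≃ₗ[ℂ] (K3Index → ℂ)) (p : complexBetti S (2 * 2)) (x : K3Index → ℂ)
    (hM : MarkedK3[S, η, p, x])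
    (t : complexBetti S (2 * 1) →ₗ[ℂ] complexBetti S (2 * 1))
    (ht_rat : ∀ y, IsRationalClass y → IsRationalClass (t y))
    (ht_N : ∀ d ∈ algebraicClasses S 1, t d = 0)
    (hte : t (η.symm x) = (e : ℂ) • η.symm x)
    (hgen : TranscendentalEndomorphismsGeneratedBy S t)
    (σ : Module.End ℂ (K3Index → ℂ)) (hσ : ∀ a b, k3Form (σ a) (σ b) = k3Form a b)
    (hσrat : ∀ v : K3Index → ℤ, ∃ w : K3Index → ℚ, σ (fun i => (v i : ℂ)) = fun i => (w i : ℂ))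
    (hconj : ∀ c : complexBetti S (2 * 1), σ (η (t c)) = thetaC θ (σ (η c))) :
    HodgeConjectureFor 4 (S ⊗ S) := by
  classical
  have hHT : Huybrechts_K3_hodgeTypes_H2 := Huybrechts_K3_hodgeTypes_H2_holds
  obtain ⟨hp0, ⟨hpint, hpgen, hηint, hηcup, h20, hline⟩, hPer⟩ := hM
  have hxpos : 0 < (k3Form (star x) x).re := hPer.2.1
  have hx0 : η.symm x ≠ 0 := fun h0 =>
    ne_zero_of_star_self_re_pos hxpos (by simpa using congrArg η h0)
  -- (b) the period `σ x` is an `e`-eigenvector of `θ_ℂ`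
  have heig : thetaC θ (σ x) = (e : ℂ) • σ x := by
    have h1 := hconj (η.symm x)
    rw [hte, map_smul, LinearEquiv.apply_symm_apply, map_smul] at h1
    exact h1.symm
  -- (c) `θ`-genericity of `σ x` (Lefschetz (1,1) on `S`), and a positive rational vector killed by `θ`
  obtain ⟨σ', hσσ', -, -, hσ'rat⟩ := exists_inverse_ratIsometry σ hσ hσrat
  have hgenσ : ∀ v : K3Index → ℚ, k3Form (fun i => (v i : ℂ)) (σ x) = 0 → θ.mulVec v = 0 := by
    intro v hv
    obtain ⟨w, hw⟩ := ratEnd_ratCast σ' hσ'rat v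
    have hwx : k3Form (fun i => (w i : ℂ)) x = 0 := by
      rw [← hw, ← hσ (σ' _) x, hσσ']
      exact hv
    have hwx' : k3Form (fun i => (w i : ℂ)) (star x) = 0 := by
      have hreal : star (fun i => (w i : ℂ)) = fun i => (w i : ℂ) := by
        funext i
        simp only [Pi.star_apply, Complex.star_def, map_ratCast]
      have h := congrArg star hwx
      rwa [star_k3Form, hreal, star_zero] at h
    have hcrat : IsRationalClass (η.symm fun i => (w i : ℂ)) :=
      (isRationalClass_iff_of_marking hS η hηint _).2 ⟨w, η.apply_symm_apply _⟩
    have hc11 : IsOfHodgeType 2 S (2 * 1) 1 1 (η.symm fun i => (w i : ℂ)) := by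
      obtain ⟨-, -, h3⟩ := hHT S hS (η.symm x) h20 hx0
      refine (h3 _).2 ⟨?_, ?_⟩
      · rw [hηcup, η.apply_symm_apply, η.apply_symm_apply, hwx, zero_smul]
      · rw [conjClass_marking_symm η hηint, hηcup, η.apply_symm_apply, η.apply_symm_apply, hwx', zero_smul]
    have hcalg : (η.symm fun i => (w i : ℂ)) ∈ algebraicClasses S 1 :=
      lefschetzOneOne_rational_holds hS.isSmoothProjective _ hcrat hc11
    have h1 := hconj (η.symm fun i => (w i : ℂ))
    rw [ht_N _ hcalg, map_zero, map_zero, η.apply_symm_apply, ← hw, hσσ', thetaC_ratCast] at h1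
    funext i
    have h2 := congrFun h1 i
    simp only [Pi.zero_apply] at h2
    exact_mod_cast h2.symm
  obtain ⟨u, hux, hupos⟩ := hPer.2.2
  obtain ⟨w, hw⟩ := hσrat u
  have hθw : θ.mulVec w = 0 := hgenσ w (by rw [← hw, hσ, hux])
  have hwpos : 0 < k3FormRat w w := by
    have h1 : (k3FormRat w w : ℚ) = ((∑ i, ∑ j, u i * k3Gram i j * u j : ℤ) : ℚ) := by
      apply Rat.cast_injective (α := ℂ)
      rw [← k3Form_ratCast, ← hw, hσ, intCast_eq_ratCast_intCast, k3Form_ratCast, k3FormRat_intCast]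
    rw [h1]
    exact_mod_cast hupos
  -- RATIONAL ORBIT DENSITY: move the period into `U` inside the isogeny class
  have hPσ := periodPt_ratIsometry σ hσ hσrat hPer
  obtain ⟨U, hU, ⟨y₁, hy₁U, hy₁, h₁₁, h₁p⟩, hcyc⟩ := hOpen (σ x) heig hPσ.1 hPσ.2.1 hgenσ
  obtain ⟨g, c, hc0, hgiso, hgrat, hgcomm, hgU⟩ := exists_ratIsometry_commute_smul_mem_of_isOpen hθsa he
    hπe hπW ⟨w, hθw, hwpos⟩ heig hPσ.1 hPσ.2.1 hU hy₁U hy₁ h₁₁ h₁p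
  set σ₁ : Module.End ℂ (K3Index → ℂ) := g ∘ₗ σ with hσ₁def
  have hσ₁ : ∀ a b, k3Form (σ₁ a) (σ₁ b) = k3Form a b := fun a b => by
    rw [hσ₁def, LinearMap.comp_apply, LinearMap.comp_apply, hgiso, hσ]
  have hσ₁rat : ∀ v : K3Index → ℤ, ∃ w : K3Index → ℚ, σ₁ (fun i => (v i : ℂ)) = fun i => (w i : ℂ) := by
    intro v
    obtain ⟨w₁, hw₁⟩ := hσrat v
    obtain ⟨w₂, hw₂⟩ := ratEnd_ratCast g hgrat w₁
    exact ⟨w₂, by rw [hσ₁def, LinearMap.comp_apply, hw₁, hw₂]⟩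
  have hconj₁ : ∀ a : complexBetti S (2 * 1), σ₁ (η (t a)) = thetaC θ (σ₁ (η a)) := by
    intro a
    have hga := LinearMap.congr_fun hgcomm (σ (η a))
    simp only [LinearMap.comp_apply] at hga
    rw [hσ₁def, LinearMap.comp_apply, LinearMap.comp_apply, hconj, hga]
  have heig₁ : thetaC θ (c • σ₁ x) = (e : ℂ) • (c • σ₁ x) := by
    have hgx := LinearMap.congr_fun hgcomm (σ x)
    simp only [LinearMap.comp_apply] at hgx
    rw [hσ₁def, LinearMap.comp_apply, map_smul, ← hgx, heig, map_smul, smul_comm]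
  have hgen₁ : ∀ v : K3Index → ℚ, k3Form (fun i => (v i : ℂ)) (c • σ₁ x) = 0 → θ.mulVec v = 0 := by
    intro v hv
    -- pull back along `g⁻¹`: `g⁻¹ v ⊥ σ x`
    obtain ⟨g', hgg', hg'g, hg', hg'rat⟩ := exists_inverse_ratIsometry g hgiso hgrat
    obtain ⟨v', hv'⟩ := ratEnd_ratCast g' hg'rat v
    have hv'x : k3Form (fun i => (v' i : ℂ)) (σ x) = 0 := by
      rw [← hv', ← hgiso (g' _) (σ x), hgg']
      rw [k3Form_smul_right, hσ₁def, LinearMap.comp_apply] at hv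
      rcases mul_eq_zero.1 hv with h | h
      · exact absurd h hc0
      · exact h
    have h1 := hgenσ v' hv'x
    -- `θ v = g θ g⁻¹ v = g θ v' = 0`
    have h2 : thetaC θ (fun i => (v i : ℂ)) = 0 := by
      have hgv := LinearMap.congr_fun hgcomm (fun i => (v' i : ℂ))
      simp only [LinearMap.comp_apply] at hgv
      rw [← hgg' (fun i => (v i : ℂ)), hv', ← hgv, thetaC_ratCast, h1]
      have h0 : (fun i => ((0 : K3Index → ℚ) i : ℂ)) = 0 := by funext i; simp
      rw [h0, map_zero]
    rw [thetaC_ratCast] at h2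
    funext i
    have h3 := congrFun h2 i
    simp only [Pi.zero_apply] at h3
    exact_mod_cast h3
  -- (a') a marked projective K3 surface at the period `c • σ₁ x ∈ U`
  obtain ⟨S', hS', η', p', hM'⟩ := exists_markedK3_ratIsometry hPS σ₁ hσ₁ hσ₁rat hPer
  have hM'' := markedK3_smul hM' hc0
  obtain ⟨hp'0, ⟨hp'int, hp'gen, hη'int, hη'cup, h20', hline'⟩, hPer'⟩ := hM''
  have hx'pos : 0 < (k3Form (star (c • σ₁ x)) (c • σ₁ x)).re := hPer'.2.1
  -- (d') the displayed input: the cycle at `c • σ₁ x`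
  have hcσ₁U : c • σ₁ x ∈ U := by rw [hσ₁def, LinearMap.comp_apply]; exact hgU
  obtain ⟨γ', hγ'alg, hγ'⟩ := hcyc S' hS' η' p' (c • σ₁ x) hcσ₁U
    ⟨hp'0, ⟨hp'int, hp'gen, hη'int, hη'cup, h20', hline'⟩, hPer'⟩ heig₁ hgen₁
  -- (e) Buskin for `ψ = η'⁻¹ σ₁ η` and `φ = η⁻¹ σ₁⁻¹ η'`
  obtain ⟨σ₁', hσσ₁', hσ₁'σ, hσ₁', hσ₁'rat⟩ := exists_inverse_ratIsometry σ₁ hσ₁ hσ₁rat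
  have hμ : complexOrientationFamily.HasPoincareDuality := OrientationFamily.hasPoincareDuality _
  have hσ1 : ∀ a b, k3Form (σ₁ a) (σ₁ b) = 1 * k3Form a b := fun a b => by rw [hσ₁, one_mul]
  have hσ'1 : ∀ a b, k3Form (σ₁' a) (σ₁' b) = 1 * k3Form a b := fun a b => by rw [hσ₁', one_mul]
  obtain ⟨γψ, hγψ, hψeq⟩ := hB complexOrientationFamily hμ S' S hS' hS p' p ⟨hp'int, hp'gen⟩ ⟨hpint, hpgen⟩
    (η'.symm.toLinearMap ∘ₗ σ₁ ∘ₗ η.toLinearMap)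
    (fun y hy => by
      simp only [LinearMap.comp_apply, LinearEquiv.coe_coe]
      exact isRationalClass_markingConj η' η σ₁ hS' hS hη'int hηint hσ₁rat hy)
    (fun i j y hy => by
      simp only [LinearMap.comp_apply, LinearEquiv.coe_coe]
      exact isOfHodgeType_markingConj η' p' (c • σ₁ x) η p x σ₁ hHT hS' hS hη'int hη'cup h20' hx'pos hηint
        hηcup hp0 h20 hxpos hσ₁rat one_ne_zero hσ1 ⟨c⁻¹, by rw [smul_smul, inv_mul_cancel₀ hc0, one_smul]⟩
        i j y hy)
    (fun a b d hd => by
      simp only [LinearMap.comp_apply, LinearEquiv.coe_coe]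
      have h1 := cupProduct_markingConj η' p' η p σ₁ hp0 hη'cup hηcup hσ1 a b d hd
      rwa [one_mul] at h1)
  obtain ⟨γφ, hγφ, hφeq⟩ := hB complexOrientationFamily hμ S S' hS hS' p p' ⟨hpint, hpgen⟩ ⟨hp'int, hp'gen⟩
    (η.symm.toLinearMap ∘ₗ σ₁' ∘ₗ η'.toLinearMap)
    (fun y hy => by
      simp only [LinearMap.comp_apply, LinearEquiv.coe_coe]
      exact isRationalClass_markingConj η η' σ₁' hS hS' hηint hη'int hσ₁'rat hy)
    (fun i j y hy => by
      simp only [LinearMap.comp_apply, LinearEquiv.coe_coe]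
      exact isOfHodgeType_markingConj η p x η' p' (c • σ₁ x) σ₁' hHT hS hS' hηint hηcup h20 hxpos hη'int
        hη'cup hp'0 h20' hx'pos hσ₁'rat one_ne_zero hσ'1 ⟨c, by rw [map_smul, hσ₁'σ]⟩ i j y hy)
    (fun a b d hd => by
      simp only [LinearMap.comp_apply, LinearEquiv.coe_coe]
      have h1 := cupProduct_markingConj η p η' p' σ₁' hp'0 hηcup hη'cup hσ'1 a b d hd
      rwa [one_mul] at h1)
  -- (f) compose the three correspondences
  have hCUP := SquareOfGenerator.cupProduct_mem_algebraicClasses_tripleProduct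
  obtain ⟨γ₁, hγ₁, hγ₁eq⟩ := corrComp_K3_of_cup complexOrientationFamily hCUP S' S' S hS' hS' hS γ' hγ'alg γψ hγψ
  obtain ⟨γ₂, hγ₂, hγ₂eq⟩ := corrComp_K3_of_cup complexOrientationFamily hCUP S S' S hS hS' hS γφ hγφ γ₁ hγ₁
  -- (g) `t = φ ∘ t' ∘ ψ` is induced by `γ₂`; Varesco's bookkeeping concludes
  refine SquareOfGenerator.squareOfGenerator S hS.isSmoothProjective t ht_rat ht_N ⟨γ₂, hγ₂, fun y => ?_⟩ hgen
  have key : t y = (η.symm.toLinearMap ∘ₗ σ₁' ∘ₗ η'.toLinearMap)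
      ((η'.symm.toLinearMap ∘ₗ (thetaC θ ∘ₗ η'.toLinearMap))
        ((η'.symm.toLinearMap ∘ₗ σ₁ ∘ₗ η.toLinearMap) y)) := by
    simp only [LinearMap.comp_apply, LinearEquiv.coe_coe, LinearEquiv.apply_symm_apply]
    rw [← hconj₁, hσ₁'σ, LinearEquiv.symm_apply_apply]
  rw [key, hφeq, hγ', hψeq, ← hγ₁eq, ← hγ₂eq]


/-- **`RMTypeDominated θ ⇒ RMTypeOpen θ`**: the displayed open-set input is WEAKER than the displayed
moduli input (take `U = Λ_ℂ`; the cycle at every `θ`-generic `θ`-eigen period comes from the spread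
family, `RMSpreadFamily.exists_algebraicClass'`, Deligne's invariant-cycle theorem being a tree theorem).
[cite: GeemenSchutt2023, §3.4 and §4.8] [cite: VoisinHodgeII2003, Thm. 4.18] -/
theorem rmTypeOpen_of_rmTypeDominated {θ : Matrix K3Index K3Index ℚ}
    (hθsa : ∀ a b : K3Index → ℂ, k3Form (thetaC θ a) b = k3Form a (thetaC θ b))
    (hDom : RMTypeDominated θ) : RMTypeOpen θ := by
  intro e y₀ hy₀ h₀₀ h₀p _
  refine ⟨Set.univ, isOpen_univ, ⟨y₀, Set.mem_univ _, hy₀, h₀₀, h₀p⟩, ?_⟩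
  intro S' hS' η' p' y _ hM' hy hgen
  obtain ⟨F'⟩ := hDom S' hS' η' p' y e hθsa hM' hy hgen
  exact F'.exists_algebraicClass'

/-- **«(O)(θ) ⇒ HC⁴(S ⊗ S)» — RM-TYPE DESCENT FROM THE DISPLAYED OPEN-SET INPUT `RMTypeOpen θ`, BY NAME**
(binders as in `RMTypeDescent.hodgeConjectureFor_square_of_rmTypeDominated`, with the `(2,0)`-eigenvalue
`e ≠ 0` of the generator and an eigenprojector certificate `π` for `(θ, e)` displayed): for an RM K3
surface `S` (`IsRealMultiplicationK3 S ρ P`) marked by `(η, p, x)`, an admissible generator `t` with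
`t(η⁻¹x) = e·η⁻¹x`, and a rational isometry `σ` conjugating `t` to the self-adjoint model `θ`: if
`RMTypeOpen θ`, then `HodgeConjectureFor 4 (S ⊗ S)`. CONDITIONAL on {`Buskin2019_hodgeIsometry_algebraic`,
`Huybrechts_K3_periodSurjective_projective`} and the displayed `hOpen`; credits nothing; HC is NOT proved
here. [cite: GeemenSchutt2023, §3.4 and §4.8] [cite: Buskin2019, Thm. 1.1] [cite: Huybrechts2016K3, Ch. 7 Thm. 4.1]
[cite: Omeara1963, §42–§43B] -/
theorem hodgeConjectureFor_square_of_rmTypeOpen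
    (hB : Buskin2019_hodgeIsometry_algebraic) (hPS : Huybrechts_K3_periodSurjective_projective)
    {θ : Matrix K3Index K3Index ℚ} (hOpen : RMTypeOpen θ)
    (hθsa : ∀ a b : K3Index → ℂ, k3Form (thetaC θ a) b = k3Form a (thetaC θ b))
    {e : ℝ} (he : e ≠ 0) {π : ℂ[X]} (hπe : π.eval (e : ℂ) = 1)
    (hπW : ∀ y : K3Index → ℂ,
      thetaC θ (aeval (thetaC θ) π (thetaC θ y)) = (e : ℂ) • aeval (thetaC θ) π (thetaC θ y))
    {S : SchemeOver ℂ} {ρ : ℕ} {P : ℚ[X]} (h : IsRealMultiplicationK3 S ρ P)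
    (η : complexBetti S (2 * 1) ≃ₗ[ℂ] (K3Index → ℂ)) (p : complexBetti S (2 * 2)) (x : K3Index → ℂ)
    (hM : MarkedK3[S, η, p, x])
    (t : complexBetti S (2 * 1) →ₗ[ℂ] complexBetti S (2 * 1))
    (ht_rat : ∀ y, IsRationalClass y → IsRationalClass (t y))
    (ht_N : ∀ d ∈ algebraicClasses S 1, t d = 0)
    (hte : t (η.symm x) = (e : ℂ) • η.symm x)
    (hgen : TranscendentalEndomorphismsGeneratedBy S t)
    (σ : Module.End ℂ (K3Index → ℂ)) (hσ : ∀ a b, k3Form (σ a) (σ b) = k3Form a b)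
    (hσrat : ∀ v : K3Index → ℤ, ∃ w : K3Index → ℚ, σ (fun i => (v i : ℂ)) = fun i => (w i : ℂ))
    (hconj : ∀ c : complexBetti S (2 * 1), σ (η (t c)) = thetaC θ (σ (η c))) :
    HodgeConjectureFor 4 (S ⊗ S) :=
  hodgeConjectureFor_square_of_open hB hPS hθsa he hπe hπW (hOpen (e : ℂ)) h.isK3Surface η p x hM t
    ht_rat ht_N hte hgen σ hσ hσrat hconj

end Summit.HodgeConjecture.HodgeConjecture.Theorems.MarkmanPartnerTransport.RMTypeOrbit

end
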